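import Mathlib
import Literature.MathematicalPhysics.QuantumLattice.LatticeScalarField
import Summits.QuantumFields.YangMills.Theorems.LangevinControlUVOSLegsFromFemtoAndGapStubLowerBump

/-!
# AtomicSynthesis (stmt-QuantumFields-28126), stub `stub_singleSlot`, step H4b — the floor-map Riemann-sum estimate on `ℝ⁴`

Prover w4 g22 (free hands), toward H4b `RiemannDisc` of planner ym-idea-11 g14's split of the registered stub
`stub_singleSlot` (`Theorems/AtomicSynthesisSingleSlotReduction`).  Pure measure theory on `ℝ⁴` (Mathlib + the tree's
lattice embedding `siteToE`), valued in an arbitrary complete normed space `F` (the induction over derivative orders in the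
sequel replaces `F` by spaces of multilinear maps):

* the floor map `y ↦ h • ⌊y/h⌋` (coordinatewise) moves points by at most `2h` and its level sets — the mesh cells — have
  volume `h⁴` (`volume_floorCell`);
* the integral of `G ∘ floor` is the finite Riemann sum `Σ_k h⁴ • G(hk)` (`integral_comp_floor_eq_sum`);
* **`norm_integral_sub_riemannSum_le`**: for `G` continuous, `L`-Lipschitz and vanishing off `closedBall x₀ r`,
  `‖∫ G − Σ_{k ∈ S} h⁴ • G(hk)‖ ≤ 2hL · (r + 2h)⁴ · vol(B₁)` for every finite `S` containing the mesh points where `G ≠ 0`.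

No stub/crux/rung/summit is closed by this file; nothing here touches Yang–Mills; the YM mass gap is NOT proved. [folklore]
-/

set_option autoImplicit false

noncomputable section

open MeasureTheory Set Metric
open Literature.MathematicalPhysics.QuantumLattice (siteToE siteToE_apply)
open Summit.QuantumFields.YangMills.Theorems.OSLegsFromFemtoAndGap.StubLower (abs_apply_le_norm
  norm_le_two_mul_of_forall_abs_le)

namespace Summit.QuantumFields.YangMills.Cruxes.AtomicSynthesis.RiemannFloor

variable {F : Type*} [NormedAddCommGroup F] [NormedSpace ℝ F] [CompleteSpace F]

/-! ## The floor map -/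

/-- Coordinates of a scaled mesh point. -/
theorem smul_siteToE_apply (h : ℝ) (k : Fin 4 → ℤ) (i : Fin 4) :
    (h • siteToE k : EuclideanSpace ℝ (Fin 4)) i = h * (k i : ℝ) := by
  simp [siteToE_apply]

/-- **The floor map moves points by at most `2h`** (each coordinate moves by less than `h`: the cell inequalities
`h ⌊t/h⌋ ≤ t < h ⌊t/h⌋ + h`, cf. the tree's `TwoOrbitSynchronisation.mul_floor_div_le_and_lt`). [folklore] -/
theorem norm_sub_floor_le {h : ℝ} (hh : 0 < h) (y : EuclideanSpace ℝ (Fin 4)) :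
    ‖y - h • siteToE (fun i => ⌊y i / h⌋)‖ ≤ 2 * h := by
  refine norm_le_two_mul_of_forall_abs_le _ hh.le fun j => ?_
  rw [PiLp.sub_apply, smul_siteToE_apply]
  have h0 : h * (y j / h) = y j := mul_div_cancel₀ (y j) hh.ne'
  have h1 : h * (⌊y j / h⌋ : ℝ) ≤ y j := by
    calc h * (⌊y j / h⌋ : ℝ) ≤ h * (y j / h) := mul_le_mul_of_nonneg_left (Int.floor_le _) hh.le
      _ = y j := h0
  have h2 : y j < h * (⌊y j / h⌋ : ℝ) + h := by
    have := Int.lt_floor_add_one (y j / h)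
    nlinarith
  rw [abs_le]; constructor <;> linarith

/-- The mesh cell of index `k` is the preimage of a box under the coordinate map. -/
theorem floorCell_eq_preimage {h : ℝ} (hh : 0 < h) (k : Fin 4 → ℤ) :
    {y : EuclideanSpace ℝ (Fin 4) | (fun i => ⌊y i / h⌋) = k} =
      (fun y : EuclideanSpace ℝ (Fin 4) => (WithLp.ofLp y : Fin 4 → ℝ)) ⁻¹'
        Set.pi univ (fun i => Ico (h * (k i : ℝ)) (h * ((k i : ℝ) + 1))) := by
  ext y
  simp only [mem_setOf_eq, mem_preimage, mem_pi, mem_univ, true_implies, mem_Ico, funext_iff]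
  refine forall_congr' fun i => ?_
  rw [Int.floor_eq_iff, le_div_iff₀ hh, div_lt_iff₀ hh]
  constructor
  · rintro ⟨h1, h2⟩; exact ⟨by linarith, by linarith⟩
  · rintro ⟨h1, h2⟩; exact ⟨by linarith, by linarith⟩

/-- Mesh cells are measurable. -/
theorem measurableSet_floorCell {h : ℝ} (hh : 0 < h) (k : Fin 4 → ℤ) :
    MeasurableSet {y : EuclideanSpace ℝ (Fin 4) | (fun i => ⌊y i / h⌋) = k} := by
  rw [floorCell_eq_preimage hh]
  exact (MeasurableSet.univ_pi fun i => measurableSet_Ico).preimage (PiLp.volume_preserving_ofLp (Fin 4)).measurable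

/-- **Mesh cells have volume `h⁴`.** [folklore] -/
theorem volume_floorCell {h : ℝ} (hh : 0 < h) (k : Fin 4 → ℤ) :
    volume {y : EuclideanSpace ℝ (Fin 4) | (fun i => ⌊y i / h⌋) = k} = ENNReal.ofReal (h ^ 4) := by
  rw [floorCell_eq_preimage hh, (PiLp.volume_preserving_ofLp (Fin 4)).measure_preimage
    (MeasurableSet.univ_pi fun i => measurableSet_Ico).nullMeasurableSet, Real.volume_pi_Ico]
  have hi : ∀ i : Fin 4, h * ((k i : ℝ) + 1) - h * (k i : ℝ) = h := fun i => by ring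
  simp only [hi, Finset.prod_const, Finset.card_univ, Fintype.card_fin]
  rw [← ENNReal.ofReal_pow hh.le]

/-! ## The integral of `G ∘ floor` is a Riemann sum -/

omit [NormedSpace ℝ F] [CompleteSpace F] in
/-- Pointwise: `G ∘ floor` is a finite combination of cell indicators. -/
theorem comp_floor_eq_sum {h : ℝ} (G : EuclideanSpace ℝ (Fin 4) → F) (S : Finset (Fin 4 → ℤ))
    (hS : ∀ k, G (h • siteToE k) ≠ 0 → k ∈ S) (y : EuclideanSpace ℝ (Fin 4)) :
    G (h • siteToE (fun i => ⌊y i / h⌋)) =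
      ∑ k ∈ S, ({y : EuclideanSpace ℝ (Fin 4) | (fun i => ⌊y i / h⌋) = k}).indicator
        (fun _ => G (h • siteToE k)) y := by
  classical
  set k₀ : Fin 4 → ℤ := fun i => ⌊y i / h⌋ with hk₀
  have hind : ∀ k, ({y : EuclideanSpace ℝ (Fin 4) | (fun i => ⌊y i / h⌋) = k}).indicator
      (fun _ => G (h • siteToE k)) y = if k = k₀ then G (h • siteToE k₀) else 0 := by
    intro k
    by_cases hk : k = k₀
    · subst hk
      rw [if_pos rfl, indicator_of_mem]
      exact rfl
    · rw [if_neg hk, indicator_of_notMem]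
      intro hy
      exact hk (Eq.symm hy)
  simp_rw [hind]
  by_cases hmem : k₀ ∈ S
  · rw [Finset.sum_ite_eq' S k₀, if_pos hmem]
  · rw [Finset.sum_ite_eq' S k₀, if_neg hmem]
    by_contra hne
    exact hmem (hS k₀ hne)

/-- **The integral of `G ∘ floor` is the finite Riemann sum `Σ_k h⁴ • G(hk)`.** [folklore] -/
theorem integral_comp_floor_eq_sum {h : ℝ} (hh : 0 < h) (G : EuclideanSpace ℝ (Fin 4) → F)
    (S : Finset (Fin 4 → ℤ)) (hS : ∀ k, G (h • siteToE k) ≠ 0 → k ∈ S) :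
    ∫ y : EuclideanSpace ℝ (Fin 4), G (h • siteToE (fun i => ⌊y i / h⌋)) = ∑ k ∈ S, (h ^ 4) • G (h • siteToE k) := by
  have hfun : (fun y : EuclideanSpace ℝ (Fin 4) => G (h • siteToE (fun i => ⌊y i / h⌋))) =
      fun y => ∑ k ∈ S, ({y : EuclideanSpace ℝ (Fin 4) | (fun i => ⌊y i / h⌋) = k}).indicator
        (fun _ => G (h • siteToE k)) y := funext (comp_floor_eq_sum G S hS)
  rw [hfun, integral_finsetSum]
  · refine Finset.sum_congr rfl fun k _ => ?_
    rw [integral_indicator_const _ (measurableSet_floorCell hh k), measureReal_def, volume_floorCell hh k,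
      ENNReal.toReal_ofReal (by positivity)]
  · intro k _
    exact (integrable_indicator_iff (measurableSet_floorCell hh k)).2
      (integrableOn_const (by rw [volume_floorCell hh k]; exact ENNReal.ofReal_ne_top))

/-! ## The floor Riemann-sum estimate -/

/-- **Floor Riemann-sum estimate on `ℝ⁴`.**  For `G` continuous, `L`-Lipschitz and vanishing off `closedBall x₀ r`, and any
finite set `S` of mesh indices containing those where `G ≠ 0`:
`‖∫ G − Σ_{k∈S} h⁴ • G(hk)‖ ≤ 2hL · (r + 2h)⁴ · vol(B₁)`. [folklore] -/
theorem norm_integral_sub_riemannSum_le {h : ℝ} (hh : 0 < h) (G : EuclideanSpace ℝ (Fin 4) → F)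
    (hG : Continuous G) (x₀ : EuclideanSpace ℝ (Fin 4)) {r L : ℝ} (hr : 0 ≤ r) (hL : 0 ≤ L)
    (hsupp : ∀ y, G y ≠ 0 → ‖y - x₀‖ ≤ r) (hLip : ∀ y y', ‖G y - G y'‖ ≤ L * ‖y - y'‖)
    (S : Finset (Fin 4 → ℤ)) (hS : ∀ k, G (h • siteToE k) ≠ 0 → k ∈ S) :
    ‖(∫ y, G y) - ∑ k ∈ S, (h ^ 4) • G (h • siteToE k)‖ ≤
      2 * h * L * ((r + 2 * h) ^ 4 * (volume (ball (0 : EuclideanSpace ℝ (Fin 4)) 1)).toReal) := by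
  -- compact support and integrability of `G`
  have hGcs : HasCompactSupport G := by
    refine HasCompactSupport.intro (isCompact_closedBall x₀ r) fun y hy => ?_
    by_contra hne
    exact hy (mem_closedBall.2 (by rw [dist_eq_norm]; exact hsupp y hne))
  have hGi : Integrable G := hG.integrable_of_hasCompactSupport hGcs
  -- the Riemann sum as the integral of `G ∘ floor`
  rw [← integral_comp_floor_eq_sum hh G S hS]
  have hfun : (fun y : EuclideanSpace ℝ (Fin 4) => G (h • siteToE (fun i => ⌊y i / h⌋))) =
      fun y => ∑ k ∈ S, ({y : EuclideanSpace ℝ (Fin 4) | (fun i => ⌊y i / h⌋) = k}).indicator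
        (fun _ => G (h • siteToE k)) y := funext (comp_floor_eq_sum G S hS)
  have hPi : Integrable (fun y : EuclideanSpace ℝ (Fin 4) => G (h • siteToE (fun i => ⌊y i / h⌋))) := by
    rw [hfun]
    refine integrable_finsetSum _ fun k _ => ?_
    exact (integrable_indicator_iff (measurableSet_floorCell hh k)).2
      (integrableOn_const (by rw [volume_floorCell hh k]; exact ENNReal.ofReal_ne_top))
  rw [← integral_sub hGi hPi]
  -- pointwise bound by the indicator of the enlarged ball
  set B : Set (EuclideanSpace ℝ (Fin 4)) := closedBall x₀ (r + 2 * h) with hB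
  have hpt : ∀ y : EuclideanSpace ℝ (Fin 4),
      ‖G y - G (h • siteToE (fun i => ⌊y i / h⌋))‖ ≤ B.indicator (fun _ => 2 * h * L) y := by
    intro y
    have hmove := norm_sub_floor_le hh y
    by_cases hy : y ∈ B
    · rw [indicator_of_mem hy]
      calc ‖G y - G (h • siteToE (fun i => ⌊y i / h⌋))‖ ≤ L * ‖y - h • siteToE (fun i => ⌊y i / h⌋)‖ := hLip _ _
        _ ≤ L * (2 * h) := mul_le_mul_of_nonneg_left hmove hL
        _ = 2 * h * L := by ring
    · rw [indicator_of_notMem hy]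
      have hy' : r + 2 * h < ‖y - x₀‖ := by
        rw [hB, mem_closedBall, dist_eq_norm] at hy; linarith
      have h1 : G y = 0 := by
        by_contra hne; have := hsupp y hne; linarith
      have h2 : G (h • siteToE (fun i => ⌊y i / h⌋)) = 0 := by
        by_contra hne
        have := hsupp _ hne
        have htri : ‖y - x₀‖ ≤ ‖y - h • siteToE (fun i => ⌊y i / h⌋)‖ + ‖h • siteToE (fun i => ⌊y i / h⌋) - x₀‖ :=
          norm_sub_le_norm_sub_add_norm_sub _ _ _
        linarith
      rw [h1, h2, sub_zero, norm_zero]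
  have hvol : (volume B).toReal = (r + 2 * h) ^ 4 * (volume (ball (0 : EuclideanSpace ℝ (Fin 4)) 1)).toReal := by
    rw [hB, Measure.addHaar_closedBall volume x₀ (by positivity), ENNReal.toReal_mul, finrank_euclideanSpace,
      Fintype.card_fin, ENNReal.toReal_ofReal (by positivity)]
  calc ‖∫ y, G y - G (h • siteToE (fun i => ⌊y i / h⌋))‖
      ≤ ∫ y, B.indicator (fun _ => 2 * h * L) y :=
        norm_integral_le_of_norm_le ((integrable_indicator_iff measurableSet_closedBall).2
          (integrableOn_const (measure_closedBall_lt_top.ne))) (Filter.Eventually.of_forall hpt)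
    _ = (volume B).toReal * (2 * h * L) := by
        rw [integral_indicator_const _ measurableSet_closedBall, measureReal_def, smul_eq_mul]
    _ = 2 * h * L * ((r + 2 * h) ^ 4 * (volume (ball (0 : EuclideanSpace ℝ (Fin 4)) 1)).toReal) := by
        rw [hvol]; ring

end Summit.QuantumFields.YangMills.Cruxes.AtomicSynthesis.RiemannFloor

end
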